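import Summits.AtomisticToContinuum.HydrodynamicLimit.Theorems.JParityClosureEvenStressEnskogEnskogRateVarianceRung0
import Summits.AtomisticToContinuum.HydrodynamicLimit.Theorems.EvenStressEnskog.Negative.TwoStreamTexture
import Literature.MathematicalPhysics.KineticTheory.EvenStatTruncationBound
import HarnessLib

/-!
# Helpers for the rung-0 identification lemma (Pin) of the crux line
# `liouville-continuity-pins-universal-contact-value` (`JParityClosure.EvenStressEnskog`,
# stmt-AtomisticToContinuum-13079)

Static, flow-free facts used by `stub_rungZeroPin`:

* the DIAGONAL truncated momentum-transfer mark `Ξ_L^{kk}` is nonnegative and dominated by the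
  untruncated mark `Ξ_P^{kk}` at unit normal, hence `0 ≤ Θ(Ξ_L^{kk}) ≤ Θ(Ξ_P^{kk})` and
  `0 ≤ B_r(Ξ_L^{kk}) ≤ B_r(Ξ_P^{kk})` for the sphere-integrated marks and the pair functionals;
* the Enskog-type rate `z ↦ ∫ w(σ³ρ_r(z,x)) B_r Ξ (z,x) dx` with a GENERIC continuous bounded
  weight `w` (in (Pin) `w = g·Ỹ` and `w = g·Y`): continuity of the integrand, measurability of the
  rate, the kinetic-energy bound for `Ξ_P^{kk}`, the uniform bound for `Ξ_L^{kk}`, and integrability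
  in time along good orbits of a hard-sphere flow (energy conservation);
* strict positivity of the Maxwellian pair average of SOME diagonal truncated mark,
  `∃ k, 0 < ∫ Θ(Ξ_L^{kk}) d(N(0,1) ⊗ N(0,1))` (the trace is `> 0` off the diagonal at relative
  speed `≤ L`, `sphereMarkP_trace_pos`, and the Gaussian charges open sets).
-/

noncomputable section

open MeasureTheory ProbabilityTheory Set Filter Topology
open scoped ENNReal InnerProductSpace BigOperators

namespace Summit.AtomisticToContinuum.HydrodynamicLimit.Theorems.EvenStressEnskog

open Literature.Analysis.FluidPDE Literature.MathematicalPhysics.KineticTheory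
open Literature.MathematicalPhysics.StatisticalMechanics Literature.Probability.Moments
open Summit.AtomisticToContinuum.HydrodynamicLimit.Theses.JParityClosure

/-! ## The diagonal marks: sign and domination -/

/-- The diagonal truncated mark `Ξ_L^{kk}` is nonnegative (`0 ≤ L`). [folklore] -/
theorem evenMarkTrunc_diag_nonneg (k : Fin 3) {L : ℝ} (hL : 0 ≤ L) (q : V3 × V3 × V3) :
    0 ≤ evenMarkTrunc k k L q := by
  unfold evenMarkTrunc
  refine mul_nonneg (mul_nonneg (le_min (le_max_right _ _) (by linarith)) (mul_self_nonneg _))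
    (speedCutoff_mem_Icc L _).1

/-- The diagonal untruncated mark `Ξ_P^{kk}` is nonnegative. [folklore] -/
theorem evenMark_diag_nonneg (k : Fin 3) (q : V3 × V3 × V3) : 0 ≤ evenMark k k q := by
  unfold evenMark
  exact mul_nonneg (le_max_right _ _) (mul_self_nonneg _)

/-- At unit normal the diagonal truncated mark is dominated by the untruncated one:
`Ξ_L^{kk}(n, v, w) ≤ Ξ_P^{kk}(n, v, w)` for `‖n‖ = 1` (any `L`: `min(·, 2L) ≤ ·`, `ψ_L ≤ 1`). [folklore] -/
theorem evenMarkTrunc_diag_le_evenMark (k : Fin 3) (L : ℝ) {q : V3 × V3 × V3}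
    (hn : ‖q.1‖ = 1) : evenMarkTrunc k k L q ≤ evenMark k k q := by
  have hk : |q.1 k| ≤ 1 := by
    have := PiLp.norm_apply_le q.1 k
    rw [hn, Real.norm_eq_abs] at this
    exact this
  unfold evenMarkTrunc evenMark
  rw [clip1_eq_self hk]
  have hm0 : 0 ≤ max ⟪q.2.2 - q.2.1, q.1⟫_ℝ 0 := le_max_right _ _
  have hc0 : 0 ≤ q.1 k * q.1 k := mul_self_nonneg _
  have hψ := speedCutoff_mem_Icc L ‖q.2.2 - q.2.1‖
  calc min (max ⟪q.2.2 - q.2.1, q.1⟫_ℝ 0) (2 * L) * (q.1 k * q.1 k) * speedCutoff L ‖q.2.2 - q.2.1‖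
      ≤ max ⟪q.2.2 - q.2.1, q.1⟫_ℝ 0 * (q.1 k * q.1 k) * 1 :=
        mul_le_mul (mul_le_mul_of_nonneg_right (min_le_left _ _) hc0) hψ.2 hψ.1
          (mul_nonneg hm0 hc0)
    _ = max ⟪q.2.2 - q.2.1, q.1⟫_ℝ 0 * (q.1 k * q.1 k) := mul_one _

/-- `0 ≤ Θ(Ξ_L^{kk})(v, w)` (`0 ≤ L`). [folklore] -/
theorem sphereMark_evenMarkTrunc_diag_nonneg (k : Fin 3) {L : ℝ} (hL : 0 ≤ L) (v w : V3) :
    0 ≤ sphereMark (evenMarkTrunc k k L) v w :=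
  integral_nonneg fun ω => mul_nonneg (evenMarkTrunc_diag_nonneg k hL _)
    (hardSphereKernel_nonneg_le v w ω).1

/-- `0 ≤ Θ(Ξ_P^{kk})(v, w)`. [folklore] -/
theorem sphereMark_evenMark_diag_nonneg (k : Fin 3) (v w : V3) :
    0 ≤ sphereMark (evenMark k k) v w :=
  integral_nonneg fun ω => mul_nonneg (evenMark_diag_nonneg k _) (hardSphereKernel_nonneg_le v w ω).1

/-- `Θ(Ξ_L^{kk})(v, w) ≤ Θ(Ξ_P^{kk})(v, w)` (every `ω ∈ S²` is a unit normal). [folklore] -/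
theorem sphereMark_evenMarkTrunc_diag_le (k : Fin 3) (L : ℝ) (v w : V3) :
    sphereMark (evenMarkTrunc k k L) v w ≤ sphereMark (evenMark k k) v w := by
  have hcP : Continuous fun ω : Metric.sphere (0 : V3) 1 =>
      evenMark k k ((ω : V3), v, w) * hardSphereKernel (w, v) ω := by
    unfold evenMark hardSphereKernel; fun_prop
  have hcL : Continuous fun ω : Metric.sphere (0 : V3) 1 =>
      evenMarkTrunc k k L ((ω : V3), v, w) * hardSphereKernel (w, v) ω := by
    have := continuous_evenMarkTrunc k k L
    unfold hardSphereKernel; fun_prop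
  unfold sphereMark
  exact integral_mono (integrable_sphereMeasure_of_continuous_V3 hcL)
    (integrable_sphereMeasure_of_continuous_V3 hcP) fun ω =>
      mul_le_mul_of_nonneg_right
        (evenMarkTrunc_diag_le_evenMark k L (q := ((ω : V3), v, w)) (norm_coe_unitSphere ω))
        (hardSphereKernel_nonneg_le v w ω).1

/-- `0 ≤ B_r(Ξ_L^{kk})(z, x₀)` (`0 ≤ L`, `0 < r`). [folklore] -/
theorem pairFunctional_evenMarkTrunc_diag_nonneg {N : ℕ} (k : Fin 3) {L r : ℝ} (hL : 0 ≤ L)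
    (hr : 0 < r) (z : Config (N + 1) (Fin 3) T3) (x₀ : T3) :
    0 ≤ pairFunctional r (evenMarkTrunc k k L) z x₀ := by
  rw [pairFunctional_eq_sum]
  exact mul_nonneg (by positivity) (Finset.sum_nonneg fun i _ => Finset.sum_nonneg fun j _ =>
    mul_nonneg (mul_nonneg (coneKernel_nonneg_le hr (z i).1 x₀).1 (coneKernel_nonneg_le hr (z j).1 x₀).1)
      (sphereMark_evenMarkTrunc_diag_nonneg k hL _ _))

/-- `0 ≤ B_r(Ξ_P^{kk})(z, x₀)` (`0 < r`). [folklore] -/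
theorem pairFunctional_evenMark_diag_nonneg {N : ℕ} (k : Fin 3) {r : ℝ} (hr : 0 < r)
    (z : Config (N + 1) (Fin 3) T3) (x₀ : T3) :
    0 ≤ pairFunctional r (evenMark k k) z x₀ := by
  rw [pairFunctional_eq_sum]
  exact mul_nonneg (by positivity) (Finset.sum_nonneg fun i _ => Finset.sum_nonneg fun j _ =>
    mul_nonneg (mul_nonneg (coneKernel_nonneg_le hr (z i).1 x₀).1 (coneKernel_nonneg_le hr (z j).1 x₀).1)
      (sphereMark_evenMark_diag_nonneg k _ _))

/-- `B_r(Ξ_L^{kk})(z, x₀) ≤ B_r(Ξ_P^{kk})(z, x₀)` (`0 < r`). [folklore] -/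
theorem pairFunctional_evenMarkTrunc_diag_le {N : ℕ} (k : Fin 3) (L : ℝ) {r : ℝ}
    (hr : 0 < r) (z : Config (N + 1) (Fin 3) T3) (x₀ : T3) :
    pairFunctional r (evenMarkTrunc k k L) z x₀ ≤ pairFunctional r (evenMark k k) z x₀ := by
  rw [pairFunctional_eq_sum, pairFunctional_eq_sum]
  refine mul_le_mul_of_nonneg_left (Finset.sum_le_sum fun i _ => Finset.sum_le_sum fun j _ =>
    mul_le_mul_of_nonneg_left (sphereMark_evenMarkTrunc_diag_le k L _ _)
      (mul_nonneg (coneKernel_nonneg_le hr (z i).1 x₀).1 (coneKernel_nonneg_le hr (z j).1 x₀).1))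
    (by positivity)

/-! ## The rate functional with a generic continuous weight -/

/-- **Joint continuity of the weighted integrand** `(z, x) ↦ w(σ³ρ_r(z,x)) · B_r Ξ (z,x)` for a
continuous weight `w` and a continuous mark `Ξ`. [folklore] -/
theorem continuous_weightIntegrand (σ : ℝ) (N : ℕ) {w : ℝ → ℝ} (hw : Continuous w)
    {Ξ : V3 × V3 × V3 → ℝ} (hΞ : Continuous Ξ) (r : ℝ) :
    Continuous fun q : Config (N + 1) (Fin 3) T3 × T3 =>
      w (σ ^ 3 * mollDensity r q.1 q.2) * pairFunctional r Ξ q.1 q.2 :=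
  (hw.comp (continuous_const.mul (continuous_mollDensity_comp r continuous_fst continuous_snd))).mul
    (continuous_pairFunctional_comp r hΞ continuous_fst continuous_snd)

/-- For one configuration the weighted integrand is continuous on the torus, hence integrable.
[folklore] -/
theorem integrable_weightIntegrand (σ : ℝ) {N : ℕ} {w : ℝ → ℝ} (hw : Continuous w)
    {Ξ : V3 × V3 × V3 → ℝ} (hΞ : Continuous Ξ) (r : ℝ) (z : Config (N + 1) (Fin 3) T3) :
    Integrable (fun x : T3 => w (σ ^ 3 * mollDensity r z x) * pairFunctional r Ξ z x) := by
  have hc : Continuous fun x : T3 => w (σ ^ 3 * mollDensity r z x) * pairFunctional r Ξ z x :=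
    (hw.comp (continuous_const.mul (continuous_mollDensity_comp r continuous_const continuous_id))).mul
      (continuous_pairFunctional_comp r hΞ continuous_const continuous_id)
  exact hc.integrable_of_hasCompactSupport (isClosed_tsupport _).isCompact

/-- **Measurability of the weighted rate** `z ↦ ∫ w(σ³ρ_r(z,x)) B_r Ξ (z,x) dx` (parametric
integral of a jointly continuous integrand). [folklore] -/
theorem measurable_weightRate (σ : ℝ) (N : ℕ) {w : ℝ → ℝ} (hw : Continuous w)
    {Ξ : V3 × V3 × V3 → ℝ} (hΞ : Continuous Ξ) (r : ℝ) :
    Measurable fun z : Config (N + 1) (Fin 3) T3 =>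
      ∫ x : T3, w (σ ^ 3 * mollDensity r z x) * pairFunctional r Ξ z x := by
  have h : Measurable (Function.uncurry fun (z : Config (N + 1) (Fin 3) T3) (x : T3) =>
      w (σ ^ 3 * mollDensity r z x) * pairFunctional r Ξ z x) :=
    (continuous_weightIntegrand σ N hw hΞ r).measurable
  exact (h.stronglyMeasurable.integral_prod_right (ν := (volume : Measure T3))).measurable

/-- **Kinetic-energy bound for the weighted rate of the diagonal untruncated mark**:
`|∫ w(σ³ρ_r) B_r(Ξ_P^{kk}) dx| ≤ K · (3/πr³)² · (0 + 4·2|S²|·E(z)/(N+1))` when `|w| ≤ K`. [folklore] -/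
theorem abs_weightRate_evenMark_le {σ : ℝ} {N : ℕ} {w : ℝ → ℝ} {K : ℝ} (hK : ∀ a, |w a| ≤ K)
    (k : Fin 3) {r : ℝ} (hr : 0 < r) (z : Config (N + 1) (Fin 3) T3) :
    |∫ x : T3, w (σ ^ 3 * mollDensity r z x) * pairFunctional r (evenMark k k) z x| ≤
      K * ((3 / (Real.pi * r ^ 3)) ^ 2 * (0 + 4 * (2 * sphereMeasure.real (univ : Set (Metric.sphere (0 : V3) 1))) *
        configEnergy z / ((N + 1 : ℕ) : ℝ))) := by
  have hK0 : 0 ≤ K := (abs_nonneg _).trans (hK 0)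
  have hb : ∀ x : T3, ‖w (σ ^ 3 * mollDensity r z x) * pairFunctional r (evenMark k k) z x‖ ≤
      K * ((3 / (Real.pi * r ^ 3)) ^ 2 * (0 + 4 * (2 * sphereMeasure.real (univ : Set (Metric.sphere (0 : V3) 1))) *
        configEnergy z / ((N + 1 : ℕ) : ℝ))) := fun x => by
    rw [Real.norm_eq_abs, abs_mul]
    exact mul_le_mul (hK _) (abs_pairFunctional_le_of_sphereMark_le (abs_sphereMark_evenMark_le' k k) hr z x)
      (abs_nonneg _) hK0
  have h := norm_integral_le_of_norm_le_const (μ := (volume : Measure T3)) (ae_of_all _ hb)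
  rwa [Real.norm_eq_abs, show (volume : Measure T3).real univ = 1 from probReal_univ, mul_one] at h

/-- **Uniform bound for the weighted rate of the truncated mark**:
`|∫ w(σ³ρ_r) B_r(Ξ_L^{kl}) dx| ≤ K · M² · 4L²|S²|`, `M = 3/(πr³)`, when `|w| ≤ K`. [folklore] -/
theorem abs_weightRate_evenMarkTrunc_le {σ : ℝ} {N : ℕ} {w : ℝ → ℝ} {K : ℝ} (hK : ∀ a, |w a| ≤ K)
    (k l : Fin 3) {L r : ℝ} (hL : 0 ≤ L) (hr : 0 < r) (z : Config (N + 1) (Fin 3) T3) :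
    |∫ x : T3, w (σ ^ 3 * mollDensity r z x) * pairFunctional r (evenMarkTrunc k l L) z x| ≤
      K * ((3 / (Real.pi * r ^ 3)) * (3 / (Real.pi * r ^ 3)) *
        (2 * L * (2 * L) * (sphereMeasure : Measure (Metric.sphere (0 : V3) 1)).real univ)) := by
  have hK0 : 0 ≤ K := (abs_nonneg _).trans (hK 0)
  have hb : ∀ x : T3, ‖w (σ ^ 3 * mollDensity r z x) * pairFunctional r (evenMarkTrunc k l L) z x‖ ≤
      K * ((3 / (Real.pi * r ^ 3)) * (3 / (Real.pi * r ^ 3)) *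
        (2 * L * (2 * L) * (sphereMeasure : Measure (Metric.sphere (0 : V3) 1)).real univ)) := fun x => by
    rw [Real.norm_eq_abs, abs_mul]
    exact mul_le_mul (hK _) (abs_pairFunctional_evenMarkTrunc_le k l hL hr z x) (abs_nonneg _) hK0
  have h := norm_integral_le_of_norm_le_const (μ := (volume : Measure T3)) (ae_of_all _ hb)
  rwa [Real.norm_eq_abs, show (volume : Measure T3).real univ = 1 from probReal_univ, mul_one] at h

/-- **The weighted rate of `Ξ_P^{kk}` is integrable in time along a good orbit** (measurable along
the measurable orbit, bounded by the conserved kinetic energy). [folklore] -/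
theorem integrableOn_weightRate_evenMark_flow {σ : ℝ} {N : ℕ}
    (Φ : HardSphereFlow (Torus.geometry (Fin 3)) (hsDiameter σ N) (N + 1))
    {z : Config (N + 1) (Fin 3) T3} (hz : z ∈ Φ.good) {w : ℝ → ℝ} (hw : Continuous w) {K : ℝ}
    (hK : ∀ a, |w a| ≤ K) (k : Fin 3) {r : ℝ} (hr : 0 < r) (τ : ℝ) :
    IntegrableOn (fun s => ∫ x : T3, w (σ ^ 3 * mollDensity r (Φ.flow s z) x) *
      pairFunctional r (evenMark k k) (Φ.flow s z) x) (Icc 0 τ) := by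
  have hmeas : Measurable fun s => ∫ x : T3, w (σ ^ 3 * mollDensity r (Φ.flow s z) x) *
      pairFunctional r (evenMark k k) (Φ.flow s z) x :=
    (measurable_weightRate σ N hw (continuous_evenMark k k) r).comp (measurable_flow_of_mem_good Φ hz)
  refine Integrable.of_bound hmeas.aestronglyMeasurable
    (K * ((3 / (Real.pi * r ^ 3)) ^ 2 * (0 + 4 * (2 * sphereMeasure.real (univ : Set (Metric.sphere (0 : V3) 1))) *
        configEnergy z / ((N + 1 : ℕ) : ℝ)))) (ae_of_all _ fun s => ?_)
  rw [Real.norm_eq_abs, ← Φ.configEnergy_flow hz s]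
  exact abs_weightRate_evenMark_le hK k hr _

/-- **The weighted rate of `Ξ_L^{kl}` is integrable in time along a good orbit** (measurable along
the measurable orbit, uniformly bounded). [folklore] -/
theorem integrableOn_weightRate_evenMarkTrunc_flow {σ : ℝ} {N : ℕ}
    (Φ : HardSphereFlow (Torus.geometry (Fin 3)) (hsDiameter σ N) (N + 1))
    {z : Config (N + 1) (Fin 3) T3} (hz : z ∈ Φ.good) {w : ℝ → ℝ} (hw : Continuous w) {K : ℝ}
    (hK : ∀ a, |w a| ≤ K) (k l : Fin 3) {L r : ℝ} (hL : 0 ≤ L) (hr : 0 < r) (τ : ℝ) :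
    IntegrableOn (fun s => ∫ x : T3, w (σ ^ 3 * mollDensity r (Φ.flow s z) x) *
      pairFunctional r (evenMarkTrunc k l L) (Φ.flow s z) x) (Icc 0 τ) := by
  have hmeas : Measurable fun s => ∫ x : T3, w (σ ^ 3 * mollDensity r (Φ.flow s z) x) *
      pairFunctional r (evenMarkTrunc k l L) (Φ.flow s z) x :=
    (measurable_weightRate σ N hw (continuous_evenMarkTrunc k l L) r).comp (measurable_flow_of_mem_good Φ hz)
  exact Integrable.of_bound hmeas.aestronglyMeasurable _
    (ae_of_all _ fun s => by
      rw [Real.norm_eq_abs]; exact abs_weightRate_evenMarkTrunc_le hK k l hL hr _)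

/-! ## The Maxwellian pair average of some diagonal truncated mark is positive -/

/-- At relative speed `< L` the diagonal truncated sphere-integrated mark IS the untruncated one.
[folklore] -/
theorem sphereMark_evenMarkTrunc_diag_eq (k : Fin 3) {L : ℝ} (hL : 0 < L) {v w : V3}
    (hs : ‖w - v‖ ≤ L) : sphereMark (evenMarkTrunc k k L) v w = sphereMark (evenMark k k) v w := by
  unfold sphereMark
  congr 1
  funext ω
  rw [evenMarkTrunc_eq_evenMark k k hL (q := ((ω : V3), v, w)) (norm_coe_unitSphere ω) hs]

/-- The isotropic unit Gaussian on `ℝ³ × ℝ³` charges nonempty open sets (it has the everywhere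
positive Lebesgue density `M ⊗ M`). [folklore] -/
theorem gaussMeasure_prod_pos_of_isOpen {U : Set (V3 × V3)} (hU : IsOpen U) (hne : U.Nonempty) :
    0 < ((gaussMeasure (0 : V3) 1).prod (gaussMeasure (0 : V3) 1)) U := by
  have hρm : Measurable fun v : V3 => ENNReal.ofReal (localMaxwellian 1 1 (0 : V3) v) :=
    (continuous_localMaxwellian 1 1 (0 : V3)).measurable.ennreal_ofReal
  have hD : Measurable fun z : V3 × V3 => ENNReal.ofReal (localMaxwellian 1 1 (0 : V3) z.1) *
      ENNReal.ofReal (localMaxwellian 1 1 (0 : V3) z.2) :=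
    (hρm.comp measurable_fst).mul (hρm.comp measurable_snd)
  rw [← withDensity_localMaxwellian_eq_gaussMeasure one_pos (0 : V3), prod_withDensity hρm hρm,
    pos_iff_ne_zero, Ne, withDensity_apply_eq_zero' hD.aemeasurable]
  have hfull : {p : V3 × V3 | ENNReal.ofReal (localMaxwellian 1 1 (0 : V3) p.1) *
      ENNReal.ofReal (localMaxwellian 1 1 (0 : V3) p.2) ≠ 0} ∩ U = U := by
    refine inter_eq_right.2 fun p _ => ?_
    exact mul_ne_zero (ENNReal.ofReal_pos.2 (localMaxwellian_pos one_pos one_pos _ _)).ne'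
      (ENNReal.ofReal_pos.2 (localMaxwellian_pos one_pos one_pos _ _)).ne'
  rw [hfull]
  exact (hU.measure_pos ((volume : Measure V3).prod (volume : Measure V3)) hne).ne'

/-- **Some diagonal truncated mark has a positive Maxwellian pair average**:
`∃ k, 0 < Θ̄_L^{kk} = ∫ Θ(Ξ_L^{kk}) d(N(0,1) ⊗ N(0,1))` (`0 < L`).  The trace `Σ_k Θ(Ξ_L^{kk})` is a
nonnegative continuous function, equal to `Σ_k Θ(Ξ_P^{kk}) > 0` (`sphereMarkP_trace_pos`) on the
nonempty open set `{v ≠ w, ‖w − v‖ < L}`, which the Gaussian charges. [folklore] -/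
theorem exists_integral_sphereMark_evenMarkTrunc_diag_pos :
    ∀ {L : ℝ}, 0 < L → ∃ k : Fin 3, 0 < ∫ p, sphereMark (evenMarkTrunc k k L) p.1 p.2
      ∂((gaussMeasure (0 : V3) 1).prod (gaussMeasure (0 : V3) 1)) := by
  intro L hL
  set γ := (gaussMeasure (0 : V3) 1).prod (gaussMeasure (0 : V3) 1) with hγ
  have hcont : ∀ k : Fin 3, Continuous fun p : V3 × V3 => sphereMark (evenMarkTrunc k k L) p.1 p.2 :=
    fun k => continuous_sphereMark (continuous_evenMarkTrunc k k L)
  have hint : ∀ k : Fin 3, Integrable (fun p : V3 × V3 => sphereMark (evenMarkTrunc k k L) p.1 p.2) γ :=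
    fun k => Integrable.of_bound (hcont k).measurable.aestronglyMeasurable _
      (ae_of_all _ fun p => by
        rw [Real.norm_eq_abs]; exact abs_sphereMark_evenMarkTrunc_le k k hL.le p.1 p.2)
  -- the trace
  set F : V3 × V3 → ℝ := fun p => ∑ k : Fin 3, sphereMark (evenMarkTrunc k k L) p.1 p.2 with hF
  have hF0 : 0 ≤ F := fun p => Finset.sum_nonneg fun k _ => sphereMark_evenMarkTrunc_diag_nonneg k hL.le _ _
  have hFint : Integrable F γ := by
    simpa only [hF] using integrable_finsetSum Finset.univ fun k _ => hint k
  have hsum : ∑ k : Fin 3, ∫ p, sphereMark (evenMarkTrunc k k L) p.1 p.2 ∂γ = ∫ p, F p ∂γ := by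
    rw [hF, integral_finsetSum _ fun k _ => hint k]
  -- positivity of the trace integral
  have hpos : 0 < ∫ p, F p ∂γ := by
    rw [integral_pos_iff_support_of_nonneg hF0 hFint]
    set U : Set (V3 × V3) := {p | p.1 ≠ p.2 ∧ ‖p.2 - p.1‖ < L} with hU
    have hUopen : IsOpen U :=
      (isOpen_ne_fun continuous_fst continuous_snd).inter
        (isOpen_lt (continuous_norm.comp (continuous_snd.sub continuous_fst)) continuous_const)
    have hUne : U.Nonempty := by
      obtain ⟨e, he⟩ := exists_ne (0 : V3)
      have hepos : 0 < ‖e‖ := norm_pos_iff.2 he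
      have hn' : ‖(L / 2 / ‖e‖) • e‖ = L / 2 := by
        rw [norm_smul, Real.norm_eq_abs, abs_of_pos (by positivity), div_mul_cancel₀ _ hepos.ne']
      refine ⟨((0 : V3), (L / 2 / ‖e‖) • e), ?_, ?_⟩
      · show (0 : V3) ≠ (L / 2 / ‖e‖) • e
        intro h
        have := congrArg (fun v : V3 => ‖v‖) h
        simp only [norm_zero] at this
        rw [hn'] at this
        linarith
      · show ‖(L / 2 / ‖e‖) • e - (0 : V3)‖ < L
        rw [sub_zero, hn']
        linarith
    have hsub : U ⊆ Function.support F := by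
      intro p hp
      rw [Function.mem_support]
      have hle : ‖p.2 - p.1‖ ≤ L := hp.2.le
      have heq : F p = ∑ k : Fin 3, sphereMark (evenMark k k) p.1 p.2 := by
        simp only [hF]
        exact Finset.sum_congr rfl fun k _ => sphereMark_evenMarkTrunc_diag_eq k hL hle
      have hP : 0 < ∑ k : Fin 3, sphereMark (evenMark k k) p.1 p.2 := by
        have h := sphereMarkP_trace_pos hp.1
        simpa only [sphereMark, evenMark] using h
      rw [heq]
      exact hP.ne'
    exact (gaussMeasure_prod_pos_of_isOpen hUopen hUne).trans_le (measure_mono hsub)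
  rw [← hsum] at hpos
  by_contra h
  push Not at h
  exact absurd (Finset.sum_nonpos fun k _ => h k) (not_le.2 hpos)

end Summit.AtomisticToContinuum.HydrodynamicLimit.Theorems.EvenStressEnskog

end
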